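import Summits.ResolutionOfSingularities.ResolutionOfSingularities.Theses.RuledResidues

/-!
# Crux `NonRuledDivisors` (stmt-ResolutionOfSingularities-18075, route `RuledResidues`) —
# the SINGULAR-CENTRE clause is load-bearing: without it the witness exists trivially (trdeg 1)

`NonRuledDivisors` asks for an affine model `R ⊆ K` over a field `k` of characteristic `p` and
INFINITELY MANY valuation rings `W ⊇ k` of `K` that are DVRs, essentially of finite type, contain
`R`, are CENTRED AT A NON-REGULAR POINT of `Spec R`, and have residue field not ruled over `k`.

Negative-side support (crux disprover, cycle 1), sorry-free and definition-free: delete ONLY the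
non-regularity of the centre (keep `R ⊆ W`) and the statement becomes TRUE for a silly reason —
in transcendence degree ONE every residue field is algebraic over `k`, hence never ruled:

* `nonRuledDivisorsNeg_linearPlace` — for `a ∈ k` the place `W_a = k[X]_(X − a)` of `k(X)`:
  contains `k[X]`, its non-units among polynomials are the multiples of `X − a`, it is a DVR, every
  element is `n/d` with `d(a) ≠ 0`, and every element is congruent to a CONSTANT modulo `𝔪`;
* `nonRuledDivisorsNeg_isFractionRing_polynomialRange` — `k[X] ⊆ k(X)` (as a `k`-subalgebra) is an
  affine model;
* `nonRuledDivisorsNeg_trdegOne_family` — over an INFINITE field the `W_a` are pairwise distinct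
  members of the mutated witness set (residue field `= k`, so no transcendental `t` exists);
* `nonRuledDivisors_withoutSingularCentre_holds` — the crux with the clause
  `¬ IsRegularLocalRing (R localised at the centre)` replaced by nothing (everything else verbatim)
  HOLDS: `p = 2`, `k = 𝔽̄₂`, `K = k(X)`, `R = k[X]`.

Moral for hunters/provers: the singular-centre clause (together with `trdeg ≥ 2`, where
"non-ruled" acquires content) is what ties the crux to resolution; nothing else in the set-builder
prevents infinitude.  This file does NOT refute the crux.
-/

set_option linter.dupNamespace false

namespace Summit.ResolutionOfSingularities.ResolutionOfSingularities.Theorems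

open Polynomial IsDedekindDomain

/-- **The linear place `W_a = k[X]_(X − a)` of `k(X)`** (existence form, definition-free):
polynomials lie in it; a polynomial is a non-unit iff `X − a` divides it; it is a DVR; every
element is `n/d` with `X − a ∤ d`; every element is a constant modulo the maximal ideal.
[folklore] -/
theorem nonRuledDivisorsNeg_linearPlace (k : Type) [Field k] (a : k) :
    ∃ W : ValuationSubring (RatFunc k),
      (∀ f : k[X], algebraMap k[X] (RatFunc k) f ∈ W) ∧
      (∀ f : k[X], algebraMap k[X] (RatFunc k) f ∈ W.nonunits ↔ (X - C a) ∣ f) ∧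
      IsDiscreteValuationRing W ∧
      (∀ x : RatFunc k, x ∈ W → ∃ n d : k[X], ¬ ((X - C a) ∣ d) ∧
        x * algebraMap k[X] (RatFunc k) d = algebraMap k[X] (RatFunc k) n) ∧
      (∀ x : RatFunc k, x ∈ W → ∃ c : k, x - algebraMap k (RatFunc k) c ∈ W.nonunits) := by
  classical
  -- the height-one prime `(X - a)` of the Dedekind domain `k[X]`
  have hprime : (Ideal.span {X - C a} : Ideal k[X]).IsPrime :=
    (Ideal.span_singleton_prime (X_sub_C_ne_zero a)).mpr (irreducible_X_sub_C a).prime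
  let v : HeightOneSpectrum k[X] :=
    ⟨Ideal.span {X - C a}, hprime, mt Ideal.span_singleton_eq_bot.mp (X_sub_C_ne_zero a)⟩
  have hv : v.asIdeal = Ideal.span {X - C a} := rfl
  let K := RatFunc k
  let W : ValuationSubring K := (v.valuation K).valuationSubring
  have hmemW : ∀ x : K, x ∈ W ↔ v.valuation K x ≤ 1 := fun x => Valuation.mem_valuationSubring_iff _ x
  have hnu : ∀ x : K, x ∈ W.nonunits ↔ v.valuation K x < 1 := by
    intro x
    rw [ValuationSubring.mem_nonunits_iff]
    exact ((Valuation.isEquiv_valuation_valuationSubring (v.valuation K)).lt_one_iff_lt_one).symm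
  have hpoly : ∀ f : k[X], algebraMap k[X] K f ∈ W := fun f => (hmemW _).mpr (v.valuation_le_one f)
  have hdvd : ∀ f : k[X], algebraMap k[X] K f ∈ W.nonunits ↔ (X - C a) ∣ f := by
    intro f
    rw [hnu, v.valuation_lt_one_iff_mem, hv, Ideal.mem_span_singleton]
  refine ⟨W, hpoly, hdvd, ?_, ?_, ?_⟩
  · -- DVR: `W` is the localisation of the Dedekind domain `k[X]` at the nonzero prime `v`
    have hW : W = (v.valuation K).valuationSubring := rfl
    rw [hW, ← HeightOneSpectrum.valuationSubringAtPrime_eq_valuationSubring]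
    haveI : v.asIdeal.IsPrime := v.isPrime
    haveI := Localization.subalgebra.isLocalization_ofField K v.asIdeal.primeCompl
      v.asIdeal.primeCompl_le_nonZeroDivisors
    exact IsLocalization.AtPrime.isDiscreteValuationRing_of_dedekind_domain k[X] v.ne_bot
      (Localization.subalgebra.ofField K v.asIdeal.primeCompl v.asIdeal.primeCompl_le_nonZeroDivisors)
  · -- `x = n / d` with `d ∉ (X - a)`
    intro x hx
    obtain ⟨n, d, hnd⟩ := HeightOneSpectrum.exists_primeCompl_mul_eq_of_integer v x ((hmemW x).mp hx)
    refine ⟨n, d, ?_, hnd⟩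
    have hd : (d : k[X]) ∉ Ideal.span {X - C a} := d.2
    rwa [Ideal.mem_span_singleton] at hd
  · -- every element is a constant modulo `𝔪`
    intro x hx
    obtain ⟨n, d, hnd⟩ := HeightOneSpectrum.exists_primeCompl_mul_eq_of_integer v x ((hmemW x).mp hx)
    have hd : (d : k[X]) ∉ v.asIdeal := d.2
    have hd' : ¬ ((X - C a) ∣ (d : k[X])) := by
      have hd₁ : (d : k[X]) ∉ Ideal.span {X - C a} := d.2
      rwa [Ideal.mem_span_singleton] at hd₁
    have hda : (d : k[X]).eval a ≠ 0 := fun h => hd' (dvd_iff_isRoot.mpr h)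
    refine ⟨n.eval a / (d : k[X]).eval a, ?_⟩
    set c : k := n.eval a / (d : k[X]).eval a with hc
    -- `(x - c) * d = n - c • d`, a polynomial vanishing at `a`
    have hvd : v.valuation K (algebraMap k[X] K d) = 1 :=
      (v.valuation_eq_one_iff_notMem).mpr hd
    have hprod : (x - algebraMap k K c) * algebraMap k[X] K d =
        algebraMap k[X] K (n - C c * d) := by
      rw [sub_mul, hnd, map_sub, map_mul, IsScalarTower.algebraMap_apply k k[X] K c,
        Polynomial.algebraMap_eq]
    have hroot : (X - C a) ∣ (n - C c * (d : k[X])) := by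
      rw [dvd_iff_isRoot, IsRoot.def, eval_sub, eval_mul, eval_C, hc,
        div_mul_cancel₀ _ hda, sub_self]
    have hlt : v.valuation K (algebraMap k[X] K (n - C c * d)) < 1 := by
      rw [v.valuation_lt_one_iff_mem]
      change n - C c * (d : k[X]) ∈ Ideal.span {X - C a}
      rw [Ideal.mem_span_singleton]
      exact hroot
    rw [hnu]
    have := congrArg (v.valuation K) hprod
    rw [map_mul, hvd, mul_one] at this
    rw [this]
    exact hlt

/-- `k[X] ⊆ k(X)` (the range of the structure map, as a `k`-subalgebra) is finitely generated.
[folklore] -/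
theorem nonRuledDivisorsNeg_polynomialRange_fg (k : Type) [Field k] :
    ((IsScalarTower.toAlgHom k k[X] (RatFunc k)).range).FG := by
  rw [← Algebra.map_top]
  exact Subalgebra.FG.map _ Algebra.FiniteType.out

/-- `k(X)` is the fraction field of the `k`-subalgebra `k[X] ⊆ k(X)` (with the inclusion as
structure map). [folklore] -/
theorem nonRuledDivisorsNeg_isFractionRing_polynomialRange (k : Type) [Field k] :
    IsFractionRing ((IsScalarTower.toAlgHom k k[X] (RatFunc k)).range) (RatFunc k) := by
  refine (isLocalization_iff _ _).mpr ⟨?_, ?_, ?_⟩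
  · rintro ⟨y, hy⟩
    have hy0 : (y : RatFunc k) ≠ 0 := by
      intro h
      exact nonZeroDivisors.ne_zero hy (Subtype.ext h)
    exact isUnit_iff_ne_zero.mpr hy0
  · intro z
    have hden : algebraMap k[X] (RatFunc k) z.denom ≠ 0 :=
      RatFunc.algebraMap_ne_zero (RatFunc.denom_ne_zero z)
    refine ⟨(⟨algebraMap k[X] (RatFunc k) z.num, ⟨z.num, rfl⟩⟩,
      ⟨⟨algebraMap k[X] (RatFunc k) z.denom, ⟨z.denom, rfl⟩⟩,
        mem_nonZeroDivisors_of_ne_zero fun h => hden (congrArg Subtype.val h)⟩), ?_⟩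
    change z * algebraMap k[X] (RatFunc k) z.denom = algebraMap k[X] (RatFunc k) z.num
    have h := RatFunc.num_div_denom z
    rw [div_eq_iff hden] at h
    exact h.symm
  · intro x y hxy
    exact ⟨1, by simpa using Subtype.ext hxy⟩

/-- **The trdeg-1 family.**  Over an INFINITE field `k`, the linear places `W_a`, `a ∈ k`, are
infinitely many members of the witness set of `NonRuledDivisors` MUTATED by deleting the
non-regularity of the centre (affine model `R = k[X] ⊆ k(X)`; residue fields `= k`, so not ruled).
[folklore] -/
theorem nonRuledDivisorsNeg_trdegOne_family (k : Type) [Field k] [Infinite k] :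
    Set.Infinite {W : ValuationSubring (RatFunc k) | ∃ hk : (∀ c : k, algebraMap k (RatFunc k) c ∈ W), IsDiscreteValuationRing W ∧ (∃ B : Subalgebra k (RatFunc k), B.FG ∧ B.toSubring ≤ W.toSubring ∧ ∀ x : RatFunc k, x ∈ W → ∃ b s : RatFunc k, b ∈ B ∧ s ∈ B ∧ s ∉ W.nonunits ∧ x * s = b) ∧ ((IsScalarTower.toAlgHom k k[X] (RatFunc k)).range.toSubring ≤ W.toSubring) ∧ ¬ (∃ (L : Subfield (IsLocalRing.ResidueField W)) (t : IsLocalRing.ResidueField W), (∀ c : k, IsLocalRing.residue W ⟨algebraMap k (RatFunc k) c, hk c⟩ ∈ L) ∧ (∀ f : Polynomial L, f ≠ 0 → Polynomial.eval₂ L.subtype t f ≠ 0) ∧ (∀ x : IsLocalRing.ResidueField W, ∃ f g : Polynomial L, Polynomial.eval₂ L.subtype t g ≠ 0 ∧ x * Polynomial.eval₂ L.subtype t g = Polynomial.eval₂ L.subtype t f))} := by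
  classical
  choose W hpoly hdvd hdvr hfrac hconst using nonRuledDivisorsNeg_linearPlace k
  have hk : ∀ a (c : k), algebraMap k (RatFunc k) c ∈ W a := fun a c => by
    rw [IsScalarTower.algebraMap_apply k k[X] (RatFunc k)]
    exact hpoly a _
  refine Set.infinite_of_injective_forall_mem (f := W) ?_ ?_
  · -- `a ↦ W_a` is injective: `X - a` is a non-unit of `W_b` only if `b = a`
    intro a b hab
    have h1 : algebraMap k[X] (RatFunc k) (X - C a) ∈ (W a).nonunits := (hdvd a _).mpr dvd_rfl
    rw [hab] at h1
    have h2 : (X - C b) ∣ (X - C a) := (hdvd b _).mp h1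
    have h3 := dvd_iff_isRoot.mp h2
    rw [IsRoot.def, eval_sub, eval_X, eval_C, sub_eq_zero] at h3
    exact h3.symm
  · intro a
    refine ⟨hk a, hdvr a, ⟨(IsScalarTower.toAlgHom k k[X] (RatFunc k)).range,
      nonRuledDivisorsNeg_polynomialRange_fg k, ?_, ?_⟩, ?_, ?_⟩
    · rintro _ ⟨f, rfl⟩
      exact hpoly a f
    · intro x hx
      obtain ⟨n, d, hd, hnd⟩ := hfrac a x hx
      exact ⟨algebraMap k[X] _ n, algebraMap k[X] _ d, ⟨n, rfl⟩,
        ⟨d, rfl⟩, fun h => hd ((hdvd a d).mp h), hnd⟩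
    · rintro _ ⟨f, rfl⟩
      exact hpoly a f
    · -- residue field `= k`: every residue is the residue of a constant, so no transcendental `t`
      rintro ⟨L, t, hLk, htrans, -⟩
      obtain ⟨y, rfl⟩ := IsLocalRing.residue_surjective t
      obtain ⟨c, hc⟩ := hconst a y y.2
      have hyc : IsLocalRing.residue (W a) y =
          IsLocalRing.residue (W a) ⟨algebraMap k (RatFunc k) c, hk a c⟩ := by
        rw [← sub_eq_zero, ← map_sub, IsLocalRing.residue_eq_zero_iff,
          ← ValuationSubring.coe_mem_nonunits_iff]
        simpa using hc
      have ht : IsLocalRing.residue (W a) y ∈ L := hyc ▸ hLk c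
      refine htrans (Polynomial.X - Polynomial.C ⟨_, ht⟩) (X_sub_C_ne_zero _) ?_
      simp

/-- **`NonRuledDivisors` WITHOUT the singular-centre clause HOLDS** (the clause
`∃ h : R ⊆ W, ¬ IsRegularLocalRing (R localised at the centre of W)` replaced by `R ⊆ W`,
everything else verbatim): `p = 2`, `k = 𝔽̄₂`, `K = k(X)`, `R = k[X]`, the places `W_a`, `a ∈ k`.
So the non-regularity of the centre is LOAD-BEARING for the crux. -/
theorem nonRuledDivisors_withoutSingularCentre_holds :
    ∃ p : ℕ, p.Prime ∧ ∃ (k K : Type) (_ : Field k) (_ : CharP k p) (_ : Field K) (_ : Algebra k K), ∃ R : Subalgebra k K, R.FG ∧ IsFractionRing R K ∧ Set.Infinite {W : ValuationSubring K | ∃ hk : (∀ c : k, algebraMap k K c ∈ W), IsDiscreteValuationRing W ∧ (∃ B : Subalgebra k K, B.FG ∧ B.toSubring ≤ W.toSubring ∧ ∀ x : K, x ∈ W → ∃ b s : K, b ∈ B ∧ s ∈ B ∧ s ∉ W.nonunits ∧ x * s = b) ∧ (R.toSubring ≤ W.toSubring) ∧ ¬ (∃ (L : Subfield (IsLocalRing.ResidueField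 W)) (t : IsLocalRing.ResidueField W), (∀ c : k, IsLocalRing.residue W ⟨algebraMap k K c, hk c⟩ ∈ L) ∧ (∀ f : Polynomial L, f ≠ 0 → Polynomial.eval₂ L.subtype t f ≠ 0) ∧ (∀ x : IsLocalRing.ResidueField W, ∃ f g : Polynomial L, Polynomial.eval₂ L.subtype t g ≠ 0 ∧ x * Polynomial.eval₂ L.subtype t g = Polynomial.eval₂ L.subtype t f))} :=
  ⟨2, Nat.prime_two, AlgebraicClosure (ZMod 2), RatFunc (AlgebraicClosure (ZMod 2)), inferInstance,
    inferInstance, inferInstance, inferInstance, (IsScalarTower.toAlgHom _ _ _).range,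
    nonRuledDivisorsNeg_polynomialRange_fg _, nonRuledDivisorsNeg_isFractionRing_polynomialRange _,
    nonRuledDivisorsNeg_trdegOne_family _⟩

end Summit.ResolutionOfSingularities.ResolutionOfSingularities.Theorems
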